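import Literature.MathematicalPhysics.QuantumFieldTheory.Balaban1983to89.B9SectBGReadCodedQY
import Literature.MathematicalPhysics.QuantumFieldTheory.Balaban1983to89.B9SectBCodedChainR7

/-!
# Balaban [B9], Thm 3.3 p. 399 with (3.46) p. 398 (and p. 398's first remark), Thm 3.4 p. 400 at a GENERIC averaging pair `(𝔮, 𝔮s)` — the block-`ℓ²`
# READ ∕ WRITE dictionary of the `L²` G frame at the letter `GbQC` (CASCADE-K piece «K2-G», stage B3; the `G[𝔮]`-edition of `B9SectBCodedChainR7`'s
# `B9SectBL2GReadCodedYR.{readGL2_GbC_printed, writeGL2_GbC}` and `B9SectBL2GCrossYR.readGL2_GbC_all`)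

T. Bałaban, *Propagators for lattice gauge theories in a background field*, Commun. Math. Phys. **99** (1985) 389–434
[`Balaban1985BackgroundPropagators`, "B9"]; [4] = [`Balaban1984PropagatorsII`]; [B8] = [`Balaban1985Averaging`].

statement-level skeleton of published theorems with citation tags; proofs where landed; nothing here is a claim about the Yang–Mills mass gap

THE PRINTED LOCUS.  (3.46) p. 398 (the block-`L²` entries of `G(U) = Δ_a(U)⁻¹`, Thm 3.3 p. 399; [4] Prop. 2.6 (2.140) p. 247), transferred to `G(U′U)` in
Sect. B — for the averaging operation `Q(U)` of (3.11)–(3.13) p. 392 = [B8] Prop. 2 p. 26.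

WHY THIS FILE (seat dag-n06-c gen 25; «⚑ K2-G SCOPE» stage M3).  The R7 dictionary reads∕writes the (3.46) block of `KACU P G x OA parB C37 C38` at the straight
`OA` through `GbC`; the proofs use the OA-generic readers `readGL2Y_KACU ∕ writeGL2Y_KACU` and `GbC_eq_conj_bondOpCoordsRY`.  THIS FILE = the same text at
`OA := GAQY 𝔮 𝔮s parS (GpY parS)` and `GbQC`: ★★ `readGL2_GbQC_printed`, ★★ `writeGL2_GbQC`, ★★ `readGL2_GbQC_all` (binders: `(𝔮, 𝔮s)` after `x`).

HONEST SCOPE.  Mechanical re-press of kernel-checked dictionaries; the (3.46) block, [4] Lemma 2.1, the scale transfers and the plaquette law are HYPOTHESES as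
in the parents; nothing of [B9] asserted; count-neutral; N06 NOT discharged; nothing continuum ∕ OS ∕ mass-gap ∕ Clay.  0 `def`, 0 `sorry`.
`--supports stmt-QuantumFields-27364`.

RELATED IN THE TREE, NOT DUPLICATED: `B9SectBL2GReadCodedY` ∕ `B9SectBL2GCrossY` ∕ `B9SectBCodedChainR7` (the `QY` editions; their letter-free tools USED),
`B9SectBGReadCodedQY` (stage B1).
-/

noncomputable section

namespace Literature.MathematicalPhysics.QuantumFieldTheory.Balaban1983to89.B9SectBL2GReadCodedQY

/-! ## §1 ★★ The fields `readGL2` ∕ `writeGL2` at `GbQC` — print's orientations -/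

section Printed

open Literature.MathematicalPhysics.QuantumFieldTheory.Balaban1983to89.B9SectBCodedClassR (RegExtraY bg9YC)
open Literature.MathematicalPhysics.QuantumFieldTheory.Balaban1983to89.B9SectBL2GReadCodedY hiding readGL2_GbC_printed writeGL2_GbC

open B6Ineq2142KLevelV1 (β)
open B6GlobalChartV1 (blkV1)
open B6KLevelCensusIndexV1 (KIdx kGeo)
open B6RandomWalk (blockPiece)
open B6RandomWalkL2 (l2n l2n_sq l2n_smul HasL2Majorant hasL2Majorant_mono)
open B9Thm34Ext (toB6)
open B9FromB6 (L2Block)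
open B9GeoNormsKLevelV1 (geo9K)
open B9Eq352DivFormLetters (conj coordEquiv conj_apply conj_neg)
open B9Eq352GradLetters (diffLetter)
open B9Eq371GradLetters (bT bU)
open B9CoReadingCoords (cdBₗ cdsBₗ cdBₗ_apply cdsBₗ_apply)
open B9PinMembersKLevelV1 (MemberY geo9Y bg9Y)
open B9Eq360DeltaPrimeAY (AfldY)
open B9SectBGpFrameCodedYR (codingYx)
open B9SectBGpLettersY (GVal decY decY_base coordC blkC)
open B9SectBL2DictionaryY (coordC_base_eq)
open B9SectBCodedCarrier (CCfg)
open B9SectBCodedReadingsUR (KACU)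
open B9SectBGWordDeltaAY (bondOpCoordsRY bondOpCoordsRY_apply GbC)
open B9SectBGReadCodedY (bondReindexY blkC_bondReindexY conj_bondOpCoordsRY_apply bondOpCoordsRY_mul bondOpCoordsRY_cdBₗ bondOpCoordsRY_cdsBₗ diffLetter_abs_eq eta_inv_eq_abs_cf GbC_eq_conj_bondOpCoordsRY)
open B9SectBL2GReadYR (readGL2Y_KACU writeGL2Y_KACU)
open B9RWSumsReadsNbr (nbr)
open Node00 (SiteY BlkY FBondY IBondY CfgY BondOpY BondParY UboxY shiftY cdB cdsB GAQY GpY SiteParY)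

open B9SectBGWordDeltaAQY (GbQC)
open B9SectBGReadCodedQY (GbQC_eq_conj_bondOpCoordsRY)
open Node00 (FBondY IBondY CfgY SiteParY BondParY)

variable {d ℓ : ℕ} {hd : 1 ≤ d + 1} {hL : Odd (ℓ + 1) ∧ 1 < ℓ + 1} {b₀ b₁ : ℝ} {Mstar : ℕ}
variable {𝔸 : Type} [NormedRing 𝔸] (P : RegExtraY d ℓ hd hL b₀ b₁ Mstar 𝔸) [NormedAlgebra ℂ 𝔸] [CompleteSpace 𝔸]
variable {ι : Type} [Fintype ι]

variable (G : Subgroup 𝔸ˣ) (x : MemberY d ℓ hd hL b₀ b₁ Mstar)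
  (𝔮 : CfgY 𝔸 x.toKIdx → ((FBondY x.toKIdx → 𝔸) →ₗ[ℂ] (IBondY x.toKIdx → 𝔸)))
  (𝔮s : CfgY 𝔸 x.toKIdx → ((IBondY x.toKIdx → 𝔸) →ₗ[ℂ] (FBondY x.toKIdx → 𝔸))) (parS : SiteParY 𝔸 x.toKIdx) (parB : BondParY 𝔸 x.toKIdx)
  (b : Module.Basis ι ℝ 𝔸) (ιB : BlkY x.toKIdx → IBondY x.toKIdx) (C37 C38 : ℝ → CfgY 𝔸 x.toKIdx → AfldY 𝔸 x.toKIdx → Prop)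
  [Fintype (geo9Y x).Site] [DecidableEq (geo9Y x).Site] {Rr : ℝ} {Hp : Prop}

/-- ★★ **FIELD `readGL2` OF THE `L²` FRAME AT NODE 00's LETTERS, PRINT's ORIENTATIONS** (at a `G`-valued base `U`): the (3.46) block of
`KACU G x (GAQY 𝔮 𝔮s parS (GpY parS)) parB C37 C38` at `base U` with `(B₀, δ)` gives block-ℓ² majorants on `(κ × SiteY) × ι` with `(c_L·B₀, δ)`, `c_L =
√|ι|·M₂·Σ_j‖b_j‖`, of `GbQC` (weight `ℓ²`), `∇♯_{inl ν}·GbQC`, `GbQC·∇♯_{inr ν}` (weight `ℓ`), `∇♯_{inl ν}·GbQC·∇♯_{inr μ}`, `∇♯_{inl ν}·∇♯_{inl μ}·GbQC`,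
`GbQC·∇♯_{inr ν}·∇♯_{inr μ}` (weight `1`) — the six printed words; letters `∇♯_k = conj b (diffLetter (bT shiftY) (bU (coordC (base U))) η⁻¹ k)`.
[cite: Balaban1985BackgroundPropagators, Thm 3.3 p.399 with (3.46) p.398, Thm 3.4 p.400; Balaban1984PropagatorsII, Prop. 2.6 (2.140) p.247, (2.51) p.232] -/
theorem readGL2_GbQC_printed [FiniteDimensional ℝ 𝔸] (hι : ∀ s, β x.toKIdx.hN x.toKIdx.D x.toKIdx.hk (ιB s) = s)
    {M₂ : ℝ} (hM₂ : 0 ≤ M₂) (hrepr : ∀ (v : 𝔸) (j : ι), |b.repr v j| ≤ M₂ * ‖v‖) (U : CfgY 𝔸 x.toKIdx) (hUG : GVal G x.toKIdx U)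
    {B₀ δ : ℝ} (hB₀ : 0 ≤ B₀) (hL2 : L2Block (KACU P G x (GAQY x.toKIdx 𝔮 𝔮s parS (GpY x.toKIdx parS)) parB C37 C38) B₀ δ (.base U)) :
    HasL2Majorant (g := toB6 (geo9Y x) Rr Hp) (fun q : (Fin (d + 1) × SiteY x.toKIdx) × ι => blkC x.toKIdx ιB q.1.2) (GbQC x.toKIdx 𝔮 𝔮s parS b (.base U)) (fun a a' => (Real.sqrt (Fintype.card ι) * M₂ * ∑ j, ‖b j‖) * B₀ * (geo9Y x).len a ^ 2 * Real.exp (-(δ * (geo9Y x).dist a a'))) ∧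
      (∀ ν, HasL2Majorant (g := toB6 (geo9Y x) Rr Hp) (fun q : (Fin (d + 1) × SiteY x.toKIdx) × ι => blkC x.toKIdx ιB q.1.2)
        (conj b (diffLetter (bT (shiftY x.toKIdx)) (bU (coordC G x.toKIdx (.base U))) (((((geo9Y x).eta : ℂ)))⁻¹) (Sum.inl ν)) * GbQC x.toKIdx 𝔮 𝔮s parS b (.base U)) (fun a a' => (Real.sqrt (Fintype.card ι) * M₂ * ∑ j, ‖b j‖) * B₀ * (geo9Y x).len a * Real.exp (-(δ * (geo9Y x).dist a a')))) ∧
      (∀ ν, HasL2Majorant (g := toB6 (geo9Y x) Rr Hp) (fun q : (Fin (d + 1) × SiteY x.toKIdx) × ι => blkC x.toKIdx ιB q.1.2)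
        (GbQC x.toKIdx 𝔮 𝔮s parS b (.base U) * conj b (diffLetter (bT (shiftY x.toKIdx)) (bU (coordC G x.toKIdx (.base U))) (((((geo9Y x).eta : ℂ)))⁻¹) (Sum.inr ν))) (fun a a' => (Real.sqrt (Fintype.card ι) * M₂ * ∑ j, ‖b j‖) * B₀ * (geo9Y x).len a * Real.exp (-(δ * (geo9Y x).dist a a')))) ∧
      (∀ ν μ, HasL2Majorant (g := toB6 (geo9Y x) Rr Hp) (fun q : (Fin (d + 1) × SiteY x.toKIdx) × ι => blkC x.toKIdx ιB q.1.2)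
        (conj b (diffLetter (bT (shiftY x.toKIdx)) (bU (coordC G x.toKIdx (.base U))) (((((geo9Y x).eta : ℂ)))⁻¹) (Sum.inl ν)) * GbQC x.toKIdx 𝔮 𝔮s parS b (.base U) *
          conj b (diffLetter (bT (shiftY x.toKIdx)) (bU (coordC G x.toKIdx (.base U))) (((((geo9Y x).eta : ℂ)))⁻¹) (Sum.inr μ))) (fun a a' => (Real.sqrt (Fintype.card ι) * M₂ * ∑ j, ‖b j‖) * B₀ * 1 * Real.exp (-(δ * (geo9Y x).dist a a')))) ∧
      (∀ ν μ, HasL2Majorant (g := toB6 (geo9Y x) Rr Hp) (fun q : (Fin (d + 1) × SiteY x.toKIdx) × ι => blkC x.toKIdx ιB q.1.2)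
        (conj b (diffLetter (bT (shiftY x.toKIdx)) (bU (coordC G x.toKIdx (.base U))) (((((geo9Y x).eta : ℂ)))⁻¹) (Sum.inl ν)) *
          conj b (diffLetter (bT (shiftY x.toKIdx)) (bU (coordC G x.toKIdx (.base U))) (((((geo9Y x).eta : ℂ)))⁻¹) (Sum.inl μ)) * GbQC x.toKIdx 𝔮 𝔮s parS b (.base U)) (fun a a' => (Real.sqrt (Fintype.card ι) * M₂ * ∑ j, ‖b j‖) * B₀ * 1 * Real.exp (-(δ * (geo9Y x).dist a a')))) ∧
      (∀ ν μ, HasL2Majorant (g := toB6 (geo9Y x) Rr Hp) (fun q : (Fin (d + 1) × SiteY x.toKIdx) × ι => blkC x.toKIdx ιB q.1.2)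
        (GbQC x.toKIdx 𝔮 𝔮s parS b (.base U) * conj b (diffLetter (bT (shiftY x.toKIdx)) (bU (coordC G x.toKIdx (.base U))) (((((geo9Y x).eta : ℂ)))⁻¹) (Sum.inr ν)) *
          conj b (diffLetter (bT (shiftY x.toKIdx)) (bU (coordC G x.toKIdx (.base U))) (((((geo9Y x).eta : ℂ)))⁻¹) (Sum.inr μ))) (fun a a' => (Real.sqrt (Fintype.card ι) * M₂ * ∑ j, ‖b j‖) * B₀ * 1 * Real.exp (-(δ * (geo9Y x).dist a a')))) := by
  letI : Fintype (geo9K x.toKIdx).Site := ‹Fintype (geo9Y x).Site›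
  letI : DecidableEq (geo9K x.toKIdx).Site := ‹DecidableEq (geo9Y x).Site›
  obtain ⟨h0, h1, h2, h3, h4, h5⟩ := readGL2Y_KACU P (Rr := Rr) (Hp := Hp) b G x (GAQY x.toKIdx 𝔮 𝔮s parS (GpY x.toKIdx parS)) parB C37 C38 ιB hι hM₂ hrepr
    hB₀ hL2
  have hco : coordC G x.toKIdx (.base U) = UboxY x.toKIdx U := coordC_base_eq G x hUG
  have hη : (((((geo9Y x).eta : ℂ))))⁻¹ = ((|x.toKIdx.cf| : ℝ) : ℂ) := eta_inv_eq_abs_cf x.toKIdx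
  have hGb : GbQC x.toKIdx 𝔮 𝔮s parS b (.base U) = conj b (bondOpCoordsRY x.toKIdx ((GAQY x.toKIdx 𝔮 𝔮s parS (GpY x.toKIdx parS) U).restrictScalars ℝ)) := by
    have h := GbQC_eq_conj_bondOpCoordsRY x 𝔮 𝔮s parS b (.base U)
    rw [decY_base] at h
    exact h
  -- def-Y's difference letters against the frame's, with their signs
  have hDl : ∀ ν, ∃ ε : ℝ, |ε| = 1 ∧ conj b (bondOpCoordsRY x.toKIdx (cdBₗ x.toKIdx U ν)) =
      ε • conj b (diffLetter (bT (shiftY x.toKIdx)) (bU (coordC G x.toKIdx (.base U))) (((((geo9Y x).eta : ℂ)))⁻¹) (Sum.inl ν)) := fun ν => by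
    rw [hco, hη]; exact exists_sign_cdBₗ x.toKIdx b U ν
  have hDr : ∀ ν, ∃ ε : ℝ, |ε| = 1 ∧ conj b (bondOpCoordsRY x.toKIdx (cdsBₗ x.toKIdx U ν)) =
      ε • conj b (diffLetter (bT (shiftY x.toKIdx)) (bU (coordC G x.toKIdx (.base U))) (((((geo9Y x).eta : ℂ)))⁻¹) (Sum.inr ν)) := fun ν => by
    rw [hco, hη]; exact exists_sign_cdsBₗ x.toKIdx b U ν
  -- reshaping of the kernels `cL * (B₀ * pref6 n * e)` into the frame's `cL * B₀ * w * e`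
  have hK : ∀ (w : IBondY x.toKIdx → ℝ) (n : Fin 6), (∀ a, B9.pref6 ((geo9Y x).len a) n = w a) →
      ∀ {T : Module.End ℝ ((Fin (d + 1) × SiteY x.toKIdx) × ι → ℝ)} {K : IBondY x.toKIdx → IBondY x.toKIdx → ℝ},
      (∀ a a', K a a' = (Real.sqrt (Fintype.card ι) * M₂ * ∑ j, ‖b j‖) *
        (B₀ * B9.pref6 ((geo9K x.toKIdx).len a) n * Real.exp (-(δ * (geo9K x.toKIdx).dist a a')))) →
      HasL2Majorant (g := toB6 (geo9Y x) Rr Hp) (fun q : (Fin (d + 1) × SiteY x.toKIdx) × ι => blkC x.toKIdx ιB q.1.2) T K →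
      HasL2Majorant (g := toB6 (geo9Y x) Rr Hp) (fun q : (Fin (d + 1) × SiteY x.toKIdx) × ι => blkC x.toKIdx ιB q.1.2) T
        (fun a a' => (Real.sqrt (Fintype.card ι) * M₂ * ∑ j, ‖b j‖) * B₀ * w a * Real.exp (-(δ * (geo9Y x).dist a a'))) := by
    intro w n hw T K hKe h
    refine hasL2Majorant_mono (g := toB6 (geo9Y x) Rr Hp) _ h fun a a' => le_of_eq ?_
    rw [hKe, ← hw a]
    show _ = (Real.sqrt (Fintype.card ι) * M₂ * ∑ j, ‖b j‖) * B₀ * B9.pref6 ((geo9K x.toKIdx).len a) n *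
      Real.exp (-(δ * (geo9K x.toKIdx).dist a a'))
    ring
  refine ⟨?_, fun ν => ?_, fun ν => ?_, fun ν μ => ?_, fun ν μ => ?_, fun ν μ => ?_⟩
  · rw [hGb]
    exact hK (fun a => (geo9Y x).len a ^ 2) 0 (fun a => rfl) (fun a a' => rfl) (hasL2Majorant_conj_bondOpCoordsRY x.toKIdx b ιB _ h0)
  · obtain ⟨ε, hε, hD⟩ := hDl ν
    have h := hasL2Majorant_conj_bondOpCoordsRY x.toKIdx b ιB _ (h1 ν)
    rw [← Module.End.mul_eq_comp, bondOpCoordsRY_mul, B9Eq352DivFormLetters.conj_mul, hD, ← hGb] at h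
    simp only [smul_mul_assoc] at h
    exact hK (fun a => (geo9Y x).len a) 1 (fun a => rfl) (fun a a' => rfl) (hasL2Majorant_smul_unit _ hε h)
  · obtain ⟨ε, hε, hD⟩ := hDr ν
    have h := hasL2Majorant_conj_bondOpCoordsRY x.toKIdx b ιB _ (h2 ν)
    rw [← Module.End.mul_eq_comp, bondOpCoordsRY_mul, B9Eq352DivFormLetters.conj_mul, hD, ← hGb] at h
    simp only [mul_smul_comm] at h
    exact hK (fun a => (geo9Y x).len a) 2 (fun a => rfl) (fun a a' => rfl) (hasL2Majorant_smul_unit _ hε h)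
  · obtain ⟨ε, hε, hD⟩ := hDl ν
    obtain ⟨ε', hε', hD'⟩ := hDr μ
    have h := hasL2Majorant_conj_bondOpCoordsRY x.toKIdx b ιB _ (h3 ν μ)
    rw [← Module.End.mul_eq_comp, ← Module.End.mul_eq_comp, bondOpCoordsRY_mul, bondOpCoordsRY_mul, B9Eq352DivFormLetters.conj_mul,
      B9Eq352DivFormLetters.conj_mul, hD, hD', ← hGb] at h
    simp only [smul_mul_assoc, mul_smul_comm, smul_smul, ← mul_assoc] at h
    exact hK (fun _ => (1 : ℝ)) 3 (fun a => rfl) (fun a a' => by ring) (hasL2Majorant_smul_unit₂ _ (by assumption) (by assumption) h)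
  · obtain ⟨ε, hε, hD⟩ := hDl ν
    obtain ⟨ε', hε', hD'⟩ := hDl μ
    have h := hasL2Majorant_conj_bondOpCoordsRY x.toKIdx b ιB _ (h4 ν μ)
    rw [← Module.End.mul_eq_comp, ← Module.End.mul_eq_comp, bondOpCoordsRY_mul, bondOpCoordsRY_mul, B9Eq352DivFormLetters.conj_mul,
      B9Eq352DivFormLetters.conj_mul, hD, hD', ← hGb] at h
    simp only [smul_mul_assoc, mul_smul_comm, smul_smul, ← mul_assoc] at h
    exact hK (fun _ => (1 : ℝ)) 4 (fun a => rfl) (fun a a' => by ring) (hasL2Majorant_smul_unit₂ _ (by assumption) (by assumption) h)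
  · obtain ⟨ε, hε, hD⟩ := hDr ν
    obtain ⟨ε', hε', hD'⟩ := hDr μ
    have h := hasL2Majorant_conj_bondOpCoordsRY x.toKIdx b ιB _ (h5 ν μ)
    rw [← Module.End.mul_eq_comp, ← Module.End.mul_eq_comp, bondOpCoordsRY_mul, bondOpCoordsRY_mul, B9Eq352DivFormLetters.conj_mul,
      B9Eq352DivFormLetters.conj_mul, hD, hD', ← hGb] at h
    simp only [smul_mul_assoc, mul_smul_comm, smul_smul, ← mul_assoc] at h
    exact hK (fun _ => (1 : ℝ)) 5 (fun a => rfl) (fun a a' => by ring) (hasL2Majorant_smul_unit₂ _ (by assumption) (by assumption) h)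

/-- ★★ **FIELD `writeGL2` OF THE `L²` FRAME AT NODE 00's LETTERS, PRINT's ORIENTATIONS**: at a (base `U`, multiplier `a`) pair with `U` `G`-valued, block-ℓ²
majorants at the coded product (`GbQC (prod U a)`; difference letters `∇♯_k` at the BASE) with `(B, δ)` of the six printed words give the (3.46) block of
`KACU` at `prod U a` with `(c_W·B, δ)`, `c_W = m_N·c_L·L²·e^{δ}` (gen 14's writer `writeGL2Y_KACU` transported).
[cite: Balaban1985BackgroundPropagators, Thm 3.4 p.400 with (3.46) p.398, p.403; Balaban1984PropagatorsII, Prop. 2.6 (2.140) p.247, (2.51) p.232] -/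
theorem writeGL2_GbQC (hι : ∀ s, β x.toKIdx.hN x.toKIdx.D x.toKIdx.hk (ιB s) = s)
    {M₂ : ℝ} (hM₂ : 0 ≤ M₂) (hrepr : ∀ (v : 𝔸) (j : ι), |b.repr v j| ≤ M₂ * ‖v‖)
    {mN : ℕ} (hnbr : ∀ y : IBondY x.toKIdx, (nbr (geo9Y x) 1 y).card ≤ mN)
    (U : CfgY 𝔸 x.toKIdx) (hUG : GVal G x.toKIdx U) (a : AfldY 𝔸 x.toKIdx) {B δ : ℝ} (hB : 0 ≤ B) (hδ : 0 ≤ δ)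
    (h0 : HasL2Majorant (g := toB6 (geo9Y x) Rr Hp) (fun q : (Fin (d + 1) × SiteY x.toKIdx) × ι => blkC x.toKIdx ιB q.1.2) (GbQC x.toKIdx 𝔮 𝔮s parS b (.prod U a)) (fun a a' => B * (geo9Y x).len a ^ 2 * Real.exp (-(δ * (geo9Y x).dist a a'))))
    (h1 : ∀ ν, HasL2Majorant (g := toB6 (geo9Y x) Rr Hp) (fun q : (Fin (d + 1) × SiteY x.toKIdx) × ι => blkC x.toKIdx ιB q.1.2)
        (conj b (diffLetter (bT (shiftY x.toKIdx)) (bU (coordC G x.toKIdx (.base U))) (((((geo9Y x).eta : ℂ)))⁻¹) (Sum.inl ν)) * GbQC x.toKIdx 𝔮 𝔮s parS b (.prod U a)) (fun a a' => B * (geo9Y x).len a * Real.exp (-(δ * (geo9Y x).dist a a'))))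
    (h2 : ∀ ν, HasL2Majorant (g := toB6 (geo9Y x) Rr Hp) (fun q : (Fin (d + 1) × SiteY x.toKIdx) × ι => blkC x.toKIdx ιB q.1.2)
        (GbQC x.toKIdx 𝔮 𝔮s parS b (.prod U a) * conj b (diffLetter (bT (shiftY x.toKIdx)) (bU (coordC G x.toKIdx (.base U))) (((((geo9Y x).eta : ℂ)))⁻¹) (Sum.inr ν))) (fun a a' => B * (geo9Y x).len a * Real.exp (-(δ * (geo9Y x).dist a a'))))
    (h3 : ∀ ν μ, HasL2Majorant (g := toB6 (geo9Y x) Rr Hp) (fun q : (Fin (d + 1) × SiteY x.toKIdx) × ι => blkC x.toKIdx ιB q.1.2)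
        (conj b (diffLetter (bT (shiftY x.toKIdx)) (bU (coordC G x.toKIdx (.base U))) (((((geo9Y x).eta : ℂ)))⁻¹) (Sum.inl ν)) * GbQC x.toKIdx 𝔮 𝔮s parS b (.prod U a) *
          conj b (diffLetter (bT (shiftY x.toKIdx)) (bU (coordC G x.toKIdx (.base U))) (((((geo9Y x).eta : ℂ)))⁻¹) (Sum.inr μ))) (fun a a' => B * 1 * Real.exp (-(δ * (geo9Y x).dist a a'))))
    (h4 : ∀ ν μ, HasL2Majorant (g := toB6 (geo9Y x) Rr Hp) (fun q : (Fin (d + 1) × SiteY x.toKIdx) × ι => blkC x.toKIdx ιB q.1.2)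
        (conj b (diffLetter (bT (shiftY x.toKIdx)) (bU (coordC G x.toKIdx (.base U))) (((((geo9Y x).eta : ℂ)))⁻¹) (Sum.inl ν)) *
          conj b (diffLetter (bT (shiftY x.toKIdx)) (bU (coordC G x.toKIdx (.base U))) (((((geo9Y x).eta : ℂ)))⁻¹) (Sum.inl μ)) * GbQC x.toKIdx 𝔮 𝔮s parS b (.prod U a)) (fun a a' => B * 1 * Real.exp (-(δ * (geo9Y x).dist a a'))))
    (h5 : ∀ ν μ, HasL2Majorant (g := toB6 (geo9Y x) Rr Hp) (fun q : (Fin (d + 1) × SiteY x.toKIdx) × ι => blkC x.toKIdx ιB q.1.2)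
        (GbQC x.toKIdx 𝔮 𝔮s parS b (.prod U a) * conj b (diffLetter (bT (shiftY x.toKIdx)) (bU (coordC G x.toKIdx (.base U))) (((((geo9Y x).eta : ℂ)))⁻¹) (Sum.inr ν)) *
          conj b (diffLetter (bT (shiftY x.toKIdx)) (bU (coordC G x.toKIdx (.base U))) (((((geo9Y x).eta : ℂ)))⁻¹) (Sum.inr μ))) (fun a a' => B * 1 * Real.exp (-(δ * (geo9Y x).dist a a')))) :
    L2Block (KACU P G x (GAQY x.toKIdx 𝔮 𝔮s parS (GpY x.toKIdx parS)) parB C37 C38)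
      ((mN : ℝ) * (Real.sqrt (Fintype.card ι) * M₂ * ∑ j, ‖b j‖) * (((ℓ + 1 : ℕ) : ℝ)) ^ 2 * Real.exp δ * B) δ (.prod U a) := by
  letI : Fintype (geo9K x.toKIdx).Site := ‹Fintype (geo9Y x).Site›
  letI : DecidableEq (geo9K x.toKIdx).Site := ‹DecidableEq (geo9Y x).Site›
  have hco : coordC G x.toKIdx (.base U) = UboxY x.toKIdx U := coordC_base_eq G x hUG
  have hη : (((((geo9Y x).eta : ℂ))))⁻¹ = ((|x.toKIdx.cf| : ℝ) : ℂ) := eta_inv_eq_abs_cf x.toKIdx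
  set W := decY x.toKIdx (.prod U a) with hW
  set O := (GAQY x.toKIdx 𝔮 𝔮s parS (GpY x.toKIdx parS) W).restrictScalars ℝ with hO
  have hGb : GbQC x.toKIdx 𝔮 𝔮s parS b (.prod U a) = conj b (bondOpCoordsRY x.toKIdx O) := GbQC_eq_conj_bondOpCoordsRY x 𝔮 𝔮s parS b (.prod U a)
  -- the frame's letters ARE unit multiples of def-Y's transported ones
  have hDl : ∀ ν, ∃ ε : ℝ, |ε| = 1 ∧ conj b (diffLetter (bT (shiftY x.toKIdx)) (bU (coordC G x.toKIdx (.base U))) (((((geo9Y x).eta : ℂ)))⁻¹) (Sum.inl ν)) =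
      ε • conj b (bondOpCoordsRY x.toKIdx (cdBₗ x.toKIdx U ν)) := fun ν => by
    obtain ⟨ε, hε, h⟩ := exists_sign_cdBₗ x.toKIdx b U ν
    have hεε : ε * ε = 1 := by nlinarith [abs_mul_abs_self ε, sq_abs ε]
    refine ⟨ε, hε, ?_⟩
    rw [hco, hη, h, smul_smul, hεε, one_smul]
  have hDr : ∀ ν, ∃ ε : ℝ, |ε| = 1 ∧ conj b (diffLetter (bT (shiftY x.toKIdx)) (bU (coordC G x.toKIdx (.base U))) (((((geo9Y x).eta : ℂ)))⁻¹) (Sum.inr ν)) =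
      ε • conj b (bondOpCoordsRY x.toKIdx (cdsBₗ x.toKIdx U ν)) := fun ν => by
    obtain ⟨ε, hε, h⟩ := exists_sign_cdsBₗ x.toKIdx b U ν
    have hεε : ε * ε = 1 := by nlinarith [abs_mul_abs_self ε, sq_abs ε]
    refine ⟨ε, hε, ?_⟩
    rw [hco, hη, h, smul_smul, hεε, one_smul]
  -- back to def-Y's carrier, word by word
  have back : ∀ {T : Module.End ℝ (FBondY x.toKIdx → 𝔸)} {K : IBondY x.toKIdx → IBondY x.toKIdx → ℝ} {ε : ℝ}, |ε| = 1 →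
      HasL2Majorant (g := toB6 (geo9Y x) Rr Hp) (fun q : (Fin (d + 1) × SiteY x.toKIdx) × ι => blkC x.toKIdx ιB q.1.2) (ε • conj b (bondOpCoordsRY x.toKIdx T)) K →
      HasL2Majorant (g := toB6 (geo9K x.toKIdx) Rr Hp) (fun p : FBondY x.toKIdx × ι => ιB (blkV1 x.toKIdx.hN x.toKIdx.D p.1)) (conj b T) K :=
    fun {T K ε} hε h => hasL2Majorant_conj_of_bondOpCoordsRY x.toKIdx b ιB _ (hasL2Majorant_smul_unit _ hε h)
  have back₂ : ∀ {T : Module.End ℝ (FBondY x.toKIdx → 𝔸)} {K : IBondY x.toKIdx → IBondY x.toKIdx → ℝ} {ε ε' : ℝ}, |ε| = 1 → |ε'| = 1 →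
      HasL2Majorant (g := toB6 (geo9Y x) Rr Hp) (fun q : (Fin (d + 1) × SiteY x.toKIdx) × ι => blkC x.toKIdx ιB q.1.2)
        ((ε * ε') • conj b (bondOpCoordsRY x.toKIdx T)) K →
      HasL2Majorant (g := toB6 (geo9K x.toKIdx) Rr Hp) (fun p : FBondY x.toKIdx × ι => ιB (blkV1 x.toKIdx.hN x.toKIdx.D p.1)) (conj b T) K :=
    fun {T K ε ε'} hε hε' h => hasL2Majorant_conj_of_bondOpCoordsRY x.toKIdx b ιB _ (hasL2Majorant_smul_unit₂ _ hε hε' h)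
  have g0 : HasL2Majorant (g := toB6 (geo9K x.toKIdx) Rr Hp) (fun p : FBondY x.toKIdx × ι => ιB (blkV1 x.toKIdx.hN x.toKIdx.D p.1)) (conj b O)
      (fun a a' => B * (geo9K x.toKIdx).len a ^ 2 * Real.exp (-(δ * (geo9K x.toKIdx).dist a a'))) :=
    hasL2Majorant_conj_of_bondOpCoordsRY x.toKIdx b ιB _ (by rw [← hGb]; exact h0)
  have g1 : ∀ ν, HasL2Majorant (g := toB6 (geo9K x.toKIdx) Rr Hp) (fun p : FBondY x.toKIdx × ι => ιB (blkV1 x.toKIdx.hN x.toKIdx.D p.1))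
      (conj b (cdBₗ x.toKIdx U ν) * conj b O) (fun a a' => B * (geo9K x.toKIdx).len a * Real.exp (-(δ * (geo9K x.toKIdx).dist a a'))) := by
    intro ν
    obtain ⟨ε, hε, hD⟩ := hDl ν
    have h := h1 ν
    rw [hD, hGb] at h
    simp only [smul_mul_assoc, ← B9Eq352DivFormLetters.conj_mul, ← bondOpCoordsRY_mul] at h
    have h' := back hε h
    rw [B9Eq352DivFormLetters.conj_mul] at h'
    exact h'
  have g2 : ∀ ν, HasL2Majorant (g := toB6 (geo9K x.toKIdx) Rr Hp) (fun p : FBondY x.toKIdx × ι => ιB (blkV1 x.toKIdx.hN x.toKIdx.D p.1))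
      (conj b O * conj b (cdsBₗ x.toKIdx U ν)) (fun a a' => B * (geo9K x.toKIdx).len a * Real.exp (-(δ * (geo9K x.toKIdx).dist a a'))) := by
    intro ν
    obtain ⟨ε, hε, hD⟩ := hDr ν
    have h := h2 ν
    rw [hD, hGb] at h
    simp only [mul_smul_comm, ← B9Eq352DivFormLetters.conj_mul, ← bondOpCoordsRY_mul] at h
    have h' := back hε h
    rw [B9Eq352DivFormLetters.conj_mul] at h'
    exact h'
  have g3 : ∀ ν μ, HasL2Majorant (g := toB6 (geo9K x.toKIdx) Rr Hp) (fun p : FBondY x.toKIdx × ι => ιB (blkV1 x.toKIdx.hN x.toKIdx.D p.1))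
      (conj b (cdBₗ x.toKIdx U ν) * conj b O * conj b (cdsBₗ x.toKIdx U μ)) (fun a a' => B * 1 * Real.exp (-(δ * (geo9K x.toKIdx).dist a a'))) := by
    intro ν μ
    obtain ⟨ε, hε, hD⟩ := hDl ν
    obtain ⟨ε', hε', hD'⟩ := hDr μ
    have h := h3 ν μ
    rw [hD, hD', hGb] at h
    simp only [smul_mul_assoc, mul_smul_comm, smul_smul, ← B9Eq352DivFormLetters.conj_mul, ← bondOpCoordsRY_mul] at h
    have h' : HasL2Majorant (g := toB6 (geo9K x.toKIdx) Rr Hp) (fun p : FBondY x.toKIdx × ι => ιB (blkV1 x.toKIdx.hN x.toKIdx.D p.1))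
        (conj b (cdBₗ x.toKIdx U ν * O * cdsBₗ x.toKIdx U μ)) (fun a a' => B * 1 * Real.exp (-(δ * (geo9K x.toKIdx).dist a a'))) := by
      exact back₂ (by assumption) (by assumption) h
    rw [B9Eq352DivFormLetters.conj_mul, B9Eq352DivFormLetters.conj_mul] at h'
    exact h'
  have g4 : ∀ ν μ, HasL2Majorant (g := toB6 (geo9K x.toKIdx) Rr Hp) (fun p : FBondY x.toKIdx × ι => ιB (blkV1 x.toKIdx.hN x.toKIdx.D p.1))
      (conj b (cdBₗ x.toKIdx U ν) * conj b (cdBₗ x.toKIdx U μ) * conj b O) (fun a a' => B * 1 * Real.exp (-(δ * (geo9K x.toKIdx).dist a a'))) := by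
    intro ν μ
    obtain ⟨ε, hε, hD⟩ := hDl ν
    obtain ⟨ε', hε', hD'⟩ := hDl μ
    have h := h4 ν μ
    rw [hD, hD', hGb] at h
    simp only [smul_mul_assoc, mul_smul_comm, smul_smul, ← B9Eq352DivFormLetters.conj_mul, ← bondOpCoordsRY_mul] at h
    have h' : HasL2Majorant (g := toB6 (geo9K x.toKIdx) Rr Hp) (fun p : FBondY x.toKIdx × ι => ιB (blkV1 x.toKIdx.hN x.toKIdx.D p.1))
        (conj b (cdBₗ x.toKIdx U ν * cdBₗ x.toKIdx U μ * O)) (fun a a' => B * 1 * Real.exp (-(δ * (geo9K x.toKIdx).dist a a'))) := by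
      exact back₂ (by assumption) (by assumption) h
    rw [B9Eq352DivFormLetters.conj_mul, B9Eq352DivFormLetters.conj_mul] at h'
    exact h'
  have g5 : ∀ ν μ, HasL2Majorant (g := toB6 (geo9K x.toKIdx) Rr Hp) (fun p : FBondY x.toKIdx × ι => ιB (blkV1 x.toKIdx.hN x.toKIdx.D p.1))
      (conj b O * conj b (cdsBₗ x.toKIdx U ν) * conj b (cdsBₗ x.toKIdx U μ)) (fun a a' => B * 1 * Real.exp (-(δ * (geo9K x.toKIdx).dist a a'))) := by
    intro ν μ
    obtain ⟨ε, hε, hD⟩ := hDr ν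
    obtain ⟨ε', hε', hD'⟩ := hDr μ
    have h := h5 ν μ
    rw [hD, hD', hGb] at h
    simp only [smul_mul_assoc, mul_smul_comm, smul_smul, ← B9Eq352DivFormLetters.conj_mul, ← bondOpCoordsRY_mul] at h
    have h' : HasL2Majorant (g := toB6 (geo9K x.toKIdx) Rr Hp) (fun p : FBondY x.toKIdx × ι => ιB (blkV1 x.toKIdx.hN x.toKIdx.D p.1))
        (conj b (O * cdsBₗ x.toKIdx U ν * cdsBₗ x.toKIdx U μ)) (fun a a' => B * 1 * Real.exp (-(δ * (geo9K x.toKIdx).dist a a'))) := by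
      exact back₂ (by assumption) (by assumption) h
    rw [B9Eq352DivFormLetters.conj_mul, B9Eq352DivFormLetters.conj_mul] at h'
    exact h'
  exact writeGL2Y_KACU P (Rr := Rr) (Hp := Hp) b G x (GAQY x.toKIdx 𝔮 𝔮s parS (GpY x.toKIdx parS)) parB C37 C38 ιB hι hM₂ hrepr hnbr U a
    O (fun Λ => rfl) (fun ν => cdBₗ x.toKIdx U ν) (fun ν => cdsBₗ x.toKIdx U ν) (fun ν Λ => cdBₗ_apply x.toKIdx U ν Λ)
    (fun ν Λ => cdsBₗ_apply x.toKIdx U ν Λ) hB hδ g0 g1 g2 g3 g4 g5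

end Printed

/-! ## §2 ★★ The field `readGL2` at `GbQC` — every orientation -/

section All

open Literature.MathematicalPhysics.QuantumFieldTheory.Balaban1983to89.B9SectBCodedClassR (RegExtraY bg9YC)
open Literature.MathematicalPhysics.QuantumFieldTheory.Balaban1983to89.B9SectBL2GCrossY hiding readGL2_GbC_all

open B6Ineq2142KLevelV1 (β)
open B6KLevelCensusIndexV1 (KIdx kGeo)
open B6RandomWalk (Triangle254 Ineq261)
open B6RandomWalkL2 (HasL2Majorant hasL2Majorant_mono)
open B9Thm34Ext (toB6)
open B9Ineq347 (ScaleTransfer)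
open B9FromB6 (L2Block)
open B9Eq39Adjoint (R plaqU)
open B9Eq369Small (Through through_self)
open B9Eq352DivFormLetters (conj)
open B9Eq352GradLetters (diffLetter)
open B9Eq371GradLetters (bT bU)
open B9Ineq363L2 (hasL2Majorant_rate_mono)
open B9PinMembersKLevelV1 (MemberY geo9Y bg9Y)
open B9Eq360DeltaPrimeAY (AfldY)
open B9SectBGpLettersY (GVal coordC blkC stencilF_blkC stencilB_blkC norm_le_one_and_inv_of_mem)
open B9SectBL2DictionaryY (coordC_base_eq)
open B9SectBCodedReadingsUR (KACU)
open B9SectBGWordDeltaAY (GbC)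
open B9SectBGClassLettersY (Reg335PlaqY)
open B9SectBL2GReadCodedYR (readGL2_GbC_printed)
open B9SectBL2SecondOrderY (PlaqLawY plaqLawY_of_holonomy_bound shiftY_comm)
open B9Eq38CrossLettersL2 (hasL2Majorant_cross_left hasL2Majorant_cross_right)
open B9Eq38SecondOrderCrossL2 (hasL2Majorant_cross2_left_inner hasL2Majorant_cross2_right_inner)
open B9Eq370SecondOrderConversionL2 (le_of_scaleTransfer)
open B9GeoLemma21KLevelV1 (geo9Y_dist_triangle geo9Y_len_pos geo9K_eta_pos geo9K_one_le_L)
open B9RWSums347DefiniteFacesWindow (geo9Y_dist_nonneg)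
open Node00 (SiteY BlkY IBondY CfgY SiteParY BondParY UboxY shiftY GAQY GpY)

open B9SectBGWordDeltaAQY (GbQC)
open B9SectBGReadCodedQY (GbQC_eq_conj_bondOpCoordsRY)
open Node00 (FBondY IBondY CfgY SiteParY BondParY)
open B9SectBL2GCrossY hiding readGL2_GbC_all

variable {d ℓ : ℕ} {hd : 1 ≤ d + 1} {hL : Odd (ℓ + 1) ∧ 1 < ℓ + 1} {b₀ b₁ : ℝ} {Mstar : ℕ}
variable {𝔸 : Type} [NormedRing 𝔸] (P : RegExtraY d ℓ hd hL b₀ b₁ Mstar 𝔸) [NormedAlgebra ℂ 𝔸] [CompleteSpace 𝔸]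
variable {ι : Type} [Fintype ι]

variable [DecidableEq ι]
variable (G : Subgroup 𝔸ˣ) (x : MemberY d ℓ hd hL b₀ b₁ Mstar)
  (𝔮 : CfgY 𝔸 x.toKIdx → ((FBondY x.toKIdx → 𝔸) →ₗ[ℂ] (IBondY x.toKIdx → 𝔸)))
  (𝔮s : CfgY 𝔸 x.toKIdx → ((IBondY x.toKIdx → 𝔸) →ₗ[ℂ] (FBondY x.toKIdx → 𝔸))) (parS : SiteParY 𝔸 x.toKIdx) (parB : BondParY 𝔸 x.toKIdx)
  (b : Module.Basis ι ℝ 𝔸) (ιB : BlkY x.toKIdx → IBondY x.toKIdx) (C37 C38 : ℝ → CfgY 𝔸 x.toKIdx → AfldY 𝔸 x.toKIdx → Prop)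
  [Fintype (geo9Y x).Site] [DecidableEq (geo9Y x).Site]

set_option maxHeartbeats 1600000 in
/-- ★★ **FIELD `readGL2` OF `L2GFrame₇` AT NODE 00's LETTERS — EVERY ORIENTATION** (p. 398 first remark, made quantitative in block-`ℓ²`): at a member with a
section `ιB` of `β`, unit-norm structure group, a real basis, [4] Lemma 2.1 at `(δ₀, 1/12)` (exponent `dL`), the scale transfers of `ℓ` and `ℓ⁻²` with one
constant `Λ ≧ 1`, and the plaquette law `PlaqLawY c_P U` of the `G`-valued base `U`: the (3.46) block of `KACU` at `base U` with `(B₀, δ₀)` gives, for ALL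
`k, l ∈ κ ⊕ κ`, block-`ℓ²` majorants of `GbQC`, `∇♯_k·GbQC`, `GbQC·∇♯_k`, `∇♯_k∇♯_l·GbQC`, `∇♯_k·GbQC·∇♯_l`, `GbQC·∇♯_k∇♯_l` with `(cLGY·B₀, δ₀/2)`; letters
`∇♯_k = conj b (diffLetter (bT shiftY) (bU (coordC (base U))) η⁻¹ k)`.
[cite: Balaban1985BackgroundPropagators, Thm 3.3 p.399 with (3.46) p.398, p.398 (first remark), (3.8) p.392, p.404 (after (3.69)); Balaban1984PropagatorsII, Prop. 2.6 (2.140)–(2.141) p.247, Lemma 2.1 p.234] -/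
theorem readGL2_GbQC_all [FiniteDimensional ℝ 𝔸] (hι : ∀ s, β x.toKIdx.hN x.toKIdx.D x.toKIdx.hk (ιB s) = s)
    (hG1 : ∀ u : 𝔸ˣ, u ∈ G → ‖(u : 𝔸)‖ ≤ 1) {M₂ : ℝ} (hM₂ : 0 ≤ M₂) (hrepr : ∀ (v : 𝔸) (j : ι), |b.repr v j| ≤ M₂ * ‖v‖)
    {δ₀ : ℝ} (hδ₀ : 0 < δ₀) {dL : ℕ} (h261 : Ineq261 dL (toB6 (geo9Y x) (0 : ℝ) True) δ₀ (1 / 12)) {Λ : ℝ} (hΛ : 1 ≤ Λ)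
    (hT1 : ScaleTransfer (geo9Y x) δ₀ (1 / 12) Λ (fun a => (geo9Y x).len a))
    (hTi2 : ScaleTransfer (geo9Y x) δ₀ (1 / 12) Λ (fun a => ((geo9Y x).len a)⁻¹ ^ 2))
    {cP : ℝ} (hcP : 0 ≤ cP) {U : CfgY 𝔸 x.toKIdx} (hUG : GVal G x.toKIdx U) (hplaq : PlaqLawY x ιB cP U)
    {B₀ : ℝ} (hB₀ : 0 ≤ B₀) (hL2 : L2Block (KACU P G x (GAQY x.toKIdx 𝔮 𝔮s parS (GpY x.toKIdx parS)) parB C37 C38) B₀ δ₀ (.base U)) :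
    HasL2Majorant (g := toB6 (geo9Y x) (0 : ℝ) True) (fun q : (Fin (d + 1) × SiteY x.toKIdx) × ι => blkC x.toKIdx ιB q.1.2) (GbQC x.toKIdx 𝔮 𝔮s parS b (.base U)) (fun a a' => cLGY cP M₂ (∑ j, ‖b j‖) (Real.sqrt (Fintype.card ι)) d dL δ₀ Λ * B₀ * (geo9Y x).len a ^ 2 * Real.exp (-(δ₀ / 2 * (geo9Y x).dist a a'))) ∧
      (∀ k : Fin (d + 1) ⊕ Fin (d + 1), HasL2Majorant (g := toB6 (geo9Y x) (0 : ℝ) True) (fun q : (Fin (d + 1) × SiteY x.toKIdx) × ι => blkC x.toKIdx ιB q.1.2)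
        (conj b (diffLetter (bT (shiftY x.toKIdx)) (bU (coordC G x.toKIdx (.base U))) (((((geo9Y x).eta : ℂ)))⁻¹) (k)) * GbQC x.toKIdx 𝔮 𝔮s parS b (.base U)) (fun a a' => cLGY cP M₂ (∑ j, ‖b j‖) (Real.sqrt (Fintype.card ι)) d dL δ₀ Λ * B₀ * (geo9Y x).len a * Real.exp (-(δ₀ / 2 * (geo9Y x).dist a a')))) ∧
      (∀ k : Fin (d + 1) ⊕ Fin (d + 1), HasL2Majorant (g := toB6 (geo9Y x) (0 : ℝ) True) (fun q : (Fin (d + 1) × SiteY x.toKIdx) × ι => blkC x.toKIdx ιB q.1.2)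
        (GbQC x.toKIdx 𝔮 𝔮s parS b (.base U) * conj b (diffLetter (bT (shiftY x.toKIdx)) (bU (coordC G x.toKIdx (.base U))) (((((geo9Y x).eta : ℂ)))⁻¹) (k))) (fun a a' => cLGY cP M₂ (∑ j, ‖b j‖) (Real.sqrt (Fintype.card ι)) d dL δ₀ Λ * B₀ * (geo9Y x).len a * Real.exp (-(δ₀ / 2 * (geo9Y x).dist a a')))) ∧
      (∀ k l : Fin (d + 1) ⊕ Fin (d + 1), HasL2Majorant (g := toB6 (geo9Y x) (0 : ℝ) True) (fun q : (Fin (d + 1) × SiteY x.toKIdx) × ι => blkC x.toKIdx ιB q.1.2)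
        (conj b (diffLetter (bT (shiftY x.toKIdx)) (bU (coordC G x.toKIdx (.base U))) (((((geo9Y x).eta : ℂ)))⁻¹) (k)) *
          conj b (diffLetter (bT (shiftY x.toKIdx)) (bU (coordC G x.toKIdx (.base U))) (((((geo9Y x).eta : ℂ)))⁻¹) (l)) * GbQC x.toKIdx 𝔮 𝔮s parS b (.base U)) (fun a a' => cLGY cP M₂ (∑ j, ‖b j‖) (Real.sqrt (Fintype.card ι)) d dL δ₀ Λ * B₀ * 1 * Real.exp (-(δ₀ / 2 * (geo9Y x).dist a a')))) ∧
      (∀ k l : Fin (d + 1) ⊕ Fin (d + 1), HasL2Majorant (g := toB6 (geo9Y x) (0 : ℝ) True) (fun q : (Fin (d + 1) × SiteY x.toKIdx) × ι => blkC x.toKIdx ιB q.1.2)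
        (conj b (diffLetter (bT (shiftY x.toKIdx)) (bU (coordC G x.toKIdx (.base U))) (((((geo9Y x).eta : ℂ)))⁻¹) (k)) * GbQC x.toKIdx 𝔮 𝔮s parS b (.base U) *
          conj b (diffLetter (bT (shiftY x.toKIdx)) (bU (coordC G x.toKIdx (.base U))) (((((geo9Y x).eta : ℂ)))⁻¹) (l))) (fun a a' => cLGY cP M₂ (∑ j, ‖b j‖) (Real.sqrt (Fintype.card ι)) d dL δ₀ Λ * B₀ * 1 * Real.exp (-(δ₀ / 2 * (geo9Y x).dist a a')))) ∧
      (∀ k l : Fin (d + 1) ⊕ Fin (d + 1), HasL2Majorant (g := toB6 (geo9Y x) (0 : ℝ) True) (fun q : (Fin (d + 1) × SiteY x.toKIdx) × ι => blkC x.toKIdx ιB q.1.2)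
        (GbQC x.toKIdx 𝔮 𝔮s parS b (.base U) * conj b (diffLetter (bT (shiftY x.toKIdx)) (bU (coordC G x.toKIdx (.base U))) (((((geo9Y x).eta : ℂ)))⁻¹) (k)) *
          conj b (diffLetter (bT (shiftY x.toKIdx)) (bU (coordC G x.toKIdx (.base U))) (((((geo9Y x).eta : ℂ)))⁻¹) (l))) (fun a a' => cLGY cP M₂ (∑ j, ‖b j‖) (Real.sqrt (Fintype.card ι)) d dL δ₀ Λ * B₀ * 1 * Real.exp (-(δ₀ / 2 * (geo9Y x).dist a a')))) := by
  -- constants and geometry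
  set η : ℝ := (kGeo x.toKIdx).eta with hηdef
  have hη0 : 0 < η := geo9K_eta_pos x.toKIdx
  set Sb : ℝ := ∑ j, ‖b j‖ with hSbdef
  set sι : ℝ := Real.sqrt (Fintype.card ι) with hsι
  set cL : ℝ := sι * M₂ * Sb with hcL
  set Bin : ℝ := cL * B₀ with hBin
  set c₁ : ℝ := B6.c1 dL δ₀ (1 / 12) with hc₁
  set d₀ : ℝ := 2 * ((d : ℝ) + 1) with hd₀
  set σ₁ : ℝ := Λ * Real.exp (1 / 12 * δ₀ * d₀) with hσ₁
  set gX : ℝ := 1 + ((1 : ℝ) ^ 2 * M₂ * Sb * sι * Real.exp (δ₀ * d₀)) * Λ * c₁ with hgX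
  set gI : ℝ := 1 + c₁ * M₂ * Sb * sι * ((1 : ℝ) ^ 2 * Real.exp (δ₀ * d₀) * Λ + (1 : ℝ) ^ 4 * cP * σ₁ * Real.exp (δ₀ * (2 * d₀)) * Λ) with hgI
  set Bx : ℝ := cLGY cP M₂ (∑ j, ‖b j‖) (Real.sqrt (Fintype.card ι)) d dL δ₀ Λ * B₀ with hBxdef
  have hSb : 0 ≤ Sb := Finset.sum_nonneg fun i _ => norm_nonneg _
  have hsι0 : 0 ≤ sι := Real.sqrt_nonneg _
  have hcL0 : 0 ≤ cL := by positivity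
  have hBin0 : 0 ≤ Bin := mul_nonneg hcL0 hB₀
  have hΛ0 : 0 ≤ Λ := le_trans zero_le_one hΛ
  have hc₁0 : 0 ≤ c₁ := B6RandomWalk.c1_nonneg dL δ₀ (1 / 12)
  have hσ₁0 : 0 ≤ σ₁ := by positivity
  have hgX1 : 1 ≤ gX := by rw [hgX]; exact le_add_of_nonneg_right (by positivity)
  have hgX0 : 0 ≤ gX := le_trans zero_le_one hgX1
  have hgI1 : 1 ≤ gI := by rw [hgI]; exact le_add_of_nonneg_right (by positivity)
  have hgI0 : 0 ≤ gI := le_trans zero_le_one hgI1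
  have hBx : Bx = gX ^ 2 * gI * Bin := by
    simp only [hBxdef, cLGY, hgX, hgI, hσ₁, hBin, hcL, hc₁, hd₀, hSbdef, hsι]; ring
  have hdnn : ∀ y y' : (geo9Y x).Site, 0 ≤ (geo9Y x).dist y y' := geo9Y_dist_nonneg x
  have htri : Triangle254 (toB6 (geo9Y x) (0 : ℝ) True) := fun p q r => geo9Y_dist_triangle x p q r
  have hlen : ∀ y : (geo9Y x).Site, 0 < (geo9Y x).len y := geo9Y_len_pos x
  have hwℓ : ∀ p : (geo9Y x).Site, 0 ≤ (geo9Y x).len p := fun p => (hlen p).le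
  have hd₀F : ∀ (μ : Fin (d + 1)) (q : Fin (d + 1) × SiteY x.toKIdx),
      (geo9Y x).dist (blkC x.toKIdx ιB q.2) (blkC x.toKIdx ιB ((bT (shiftY x.toKIdx)) μ q).2) ≤ d₀ := fun μ q => stencilF_blkC x.toKIdx ιB hι μ q.2
  have hd₀B : ∀ (μ : Fin (d + 1)) (q : Fin (d + 1) × SiteY x.toKIdx),
      (geo9Y x).dist (blkC x.toKIdx ιB q.2) (blkC x.toKIdx ιB (((bT (shiftY x.toKIdx)) μ).symm q).2) ≤ d₀ := fun μ q => stencilB_blkC x.toKIdx ιB hι μ q.2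
  have hd₀FB : ∀ (μ : Fin (d + 1)) (q : Fin (d + 1) × SiteY x.toKIdx),
      (geo9Y x).dist (blkC x.toKIdx ιB q.2) (blkC x.toKIdx ιB ((bT (shiftY x.toKIdx)) μ q).2) ≤ d₀ ∧
      (geo9Y x).dist (blkC x.toKIdx ιB q.2) (blkC x.toKIdx ιB (((bT (shiftY x.toKIdx)) μ).symm q).2) ≤ d₀ := fun μ q => ⟨hd₀F μ q, hd₀B μ q⟩
  have hρu : ∀ (μ : Fin (d + 1)) (q : Fin (d + 1) × SiteY x.toKIdx), ‖(((bU (UboxY x.toKIdx U)) μ q : 𝔸ˣ) : 𝔸)‖ ≤ 1 ∧ ‖((((bU (UboxY x.toKIdx U)) μ q)⁻¹ : 𝔸ˣ) : 𝔸)‖ ≤ 1 :=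
    fun μ q => norm_le_one_and_inv_of_mem G hG1 (hUG μ _ : UboxY x.toKIdx U μ q.2 ∈ G)
  have hαδ : 0 ≤ 1 / 12 * δ₀ := by positivity
  have hT0 : ScaleTransfer (geo9Y x) δ₀ (1 / 12) Λ (fun _ => (1 : ℝ)) := fun y y' => by
    rw [mul_one, mul_one]
    have : Real.exp (-(1 / 12 * δ₀ * (geo9Y x).dist y y')) ≤ 1 := Real.exp_le_one_iff.2 (by nlinarith [hdnn y y', hδ₀.le])
    exact this.trans hΛ
  have heta : ∀ y : (geo9Y x).Site, η ≤ (geo9Y x).len y := B9SectBL2SecondOrderY.eta_le_len x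
  have hcomm : ∀ (μ ν : Fin (d + 1)) (q : Fin (d + 1) × SiteY x.toKIdx), (bT (shiftY x.toKIdx)) μ ((bT (shiftY x.toKIdx)) ν q) = (bT (shiftY x.toKIdx)) ν ((bT (shiftY x.toKIdx)) μ q) :=
    fun μ ν q => Prod.ext rfl (shiftY_comm x μ ν q.2)
  have hσ : ∀ (ν : Fin (d + 1)) (q : Fin (d + 1) × SiteY x.toKIdx), ((geo9Y x).len (blkC x.toKIdx ιB (((bT (shiftY x.toKIdx)) ν).symm q).2))⁻¹ ^ 2
      ≤ σ₁ * ((geo9Y x).len (blkC x.toKIdx ιB q.2))⁻¹ ^ 2 := fun ν q =>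
    le_of_scaleTransfer (w := fun a => ((geo9Y x).len a)⁻¹ ^ 2) hTi2 hαδ (hd₀B ν q) (pow_nonneg (inv_nonneg.mpr (hlen _).le) _)
  have hplaq' : ∀ (μ ν : Fin (d + 1)) (q : Fin (d + 1) × SiteY x.toKIdx) (X : 𝔸),
      ‖R ((bU (UboxY x.toKIdx U)) μ q * (bU (UboxY x.toKIdx U)) ν ((bT (shiftY x.toKIdx)) μ q)) X - R ((bU (UboxY x.toKIdx U)) ν q * (bU (UboxY x.toKIdx U)) μ ((bT (shiftY x.toKIdx)) ν q)) X‖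
        ≤ cP * (η * ((geo9Y x).len (blkC x.toKIdx ιB q.2))⁻¹) ^ 2 * ‖X‖ := fun μ ν q X => hplaq μ ν q.2 X
  -- the letters: `D k` at the genuine `U_□` (the frame's `coordC (base U)` IS `U_□` at a `G`-valued base)
  have hco : coordC G x.toKIdx (.base U) = UboxY x.toKIdx U := coordC_base_eq G x hUG
  set Gb := GbQC x.toKIdx 𝔮 𝔮s parS b (.base U) with hGb
  set D : Fin (d + 1) ⊕ Fin (d + 1) → Module.End ℝ ((Fin (d + 1) × SiteY x.toKIdx) → 𝔸) :=
    fun k => diffLetter (bT (shiftY x.toKIdx)) (bU (UboxY x.toKIdx U)) (((η : ℂ))⁻¹) k with hD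
  have hDc : ∀ k, conj b (diffLetter (bT (shiftY x.toKIdx)) (bU (coordC G x.toKIdx (.base U))) (((((geo9Y x).eta : ℂ)))⁻¹) (k)) = conj b (D k) := fun k => by
    rw [hco]; rfl
  simp only [hDc]
  -- READ print's orientations (gen 14's `readGL2_GbQC_printed`), rate δ₀, constant Bin
  obtain ⟨r0, r1', r2', r4', r3', r5'⟩ := readGL2_GbQC_printed P (Rr := (0 : ℝ)) (Hp := True) G x 𝔮 𝔮s parS parB b ιB C37 C38 hι hM₂ hrepr U hUG hB₀ hL2
  simp only [hDc] at r1' r2' r3' r4' r5'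
  have hK : ∀ (w : (geo9Y x).Site → ℝ) (p q : (geo9Y x).Site), (Real.sqrt (Fintype.card ι) * M₂ * ∑ j, ‖b j‖) * B₀ * w p * Real.exp (-(δ₀ * (geo9Y x).dist p q))
      = Bin * w p * Real.exp (-(δ₀ * (geo9Y x).dist p q)) := fun w p q => by rw [hBin, hcL, hsι, hSbdef]
  have r0' : HasL2Majorant (g := toB6 (geo9Y x) (0 : ℝ) True) (fun q : (Fin (d + 1) × SiteY x.toKIdx) × ι => blkC x.toKIdx ιB q.1.2) Gb (fun p q => Bin * (geo9Y x).len p ^ 2 * Real.exp (-(δ₀ * (geo9Y x).dist p q))) :=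
    hasL2Majorant_mono (g := toB6 (geo9Y x) (0 : ℝ) True) _ r0 fun p q => le_of_eq (hK (fun p => (geo9Y x).len p ^ 2) p q)
  have r1 : ∀ μ, HasL2Majorant (g := toB6 (geo9Y x) (0 : ℝ) True) (fun q : (Fin (d + 1) × SiteY x.toKIdx) × ι => blkC x.toKIdx ιB q.1.2) (conj b (D (Sum.inl μ)) * Gb) (fun p q => Bin * (geo9Y x).len p * Real.exp (-(δ₀ * (geo9Y x).dist p q))) := fun μ =>
    hasL2Majorant_mono (g := toB6 (geo9Y x) (0 : ℝ) True) _ (r1' μ) fun p q => le_of_eq (hK (fun p => (geo9Y x).len p) p q)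
  have r2 : ∀ μ, HasL2Majorant (g := toB6 (geo9Y x) (0 : ℝ) True) (fun q : (Fin (d + 1) × SiteY x.toKIdx) × ι => blkC x.toKIdx ιB q.1.2) (Gb * conj b (D (Sum.inr μ))) (fun p q => Bin * (geo9Y x).len p * Real.exp (-(δ₀ * (geo9Y x).dist p q))) := fun μ =>
    hasL2Majorant_mono (g := toB6 (geo9Y x) (0 : ℝ) True) _ (r2' μ) fun p q => le_of_eq (hK (fun p => (geo9Y x).len p) p q)
  have r3 : ∀ μ ν, HasL2Majorant (g := toB6 (geo9Y x) (0 : ℝ) True) (fun q : (Fin (d + 1) × SiteY x.toKIdx) × ι => blkC x.toKIdx ιB q.1.2) (conj b (D (Sum.inl μ)) * conj b (D (Sum.inl ν)) * Gb) (fun p q => Bin * 1 * Real.exp (-(δ₀ * (geo9Y x).dist p q))) := fun μ ν =>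
    hasL2Majorant_mono (g := toB6 (geo9Y x) (0 : ℝ) True) _ (r3' μ ν) fun p q => le_of_eq (hK (fun _ => 1) p q)
  have r4 : ∀ μ ν, HasL2Majorant (g := toB6 (geo9Y x) (0 : ℝ) True) (fun q : (Fin (d + 1) × SiteY x.toKIdx) × ι => blkC x.toKIdx ιB q.1.2) (conj b (D (Sum.inl μ)) * Gb * conj b (D (Sum.inr ν))) (fun p q => Bin * 1 * Real.exp (-(δ₀ * (geo9Y x).dist p q))) := fun μ ν =>
    hasL2Majorant_mono (g := toB6 (geo9Y x) (0 : ℝ) True) _ (r4' μ ν) fun p q => le_of_eq (hK (fun _ => 1) p q)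
  have r5 : ∀ μ ν, HasL2Majorant (g := toB6 (geo9Y x) (0 : ℝ) True) (fun q : (Fin (d + 1) × SiteY x.toKIdx) × ι => blkC x.toKIdx ιB q.1.2) (Gb * conj b (D (Sum.inr μ)) * conj b (D (Sum.inr ν))) (fun p q => Bin * 1 * Real.exp (-(δ₀ * (geo9Y x).dist p q))) := fun μ ν =>
    hasL2Majorant_mono (g := toB6 (geo9Y x) (0 : ℝ) True) _ (r5' μ ν) fun p q => le_of_eq (hK (fun _ => 1) p q)
  -- rates
  set ρ₁ : ℝ := 5 * δ₀ / 6 with hρ₁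
  set ρ₂ : ℝ := 2 * δ₀ / 3 with hρ₂
  have hρ₁0 : 0 ≤ ρ₁ := by rw [hρ₁]; positivity
  have hρ₂0 : 0 ≤ ρ₂ := by rw [hρ₂]; positivity
  have hr₁ : ρ₁ + (1 / 12 + 1 / 12) * δ₀ ≤ δ₀ := by rw [hρ₁]; linarith
  have hρ₁δ : ρ₁ ≤ δ₀ := by rw [hρ₁]; linarith
  have hr₂ : ρ₂ + (1 / 12 + 1 / 12) * δ₀ ≤ ρ₁ := by rw [hρ₁, hρ₂]; linarith
  have hρ₂₁ : ρ₂ ≤ ρ₁ := by rw [hρ₁, hρ₂]; linarith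
  -- the outer and inner step constants are bounded by `g_X`, `g_I` times the input constant (rates `≦ δ₀`)
  have hexp1 : ∀ r : ℝ, r ≤ δ₀ → Real.exp (r * d₀) ≤ Real.exp (δ₀ * d₀) := fun r hr =>
    Real.exp_le_exp.2 (mul_le_mul_of_nonneg_right hr (by rw [hd₀]; positivity))
  have hexp2 : ∀ r : ℝ, r ≤ δ₀ → Real.exp (r * (2 * d₀)) ≤ Real.exp (δ₀ * (2 * d₀)) := fun r hr =>
    Real.exp_le_exp.2 (mul_le_mul_of_nonneg_right hr (by rw [hd₀]; positivity))
  have hstep : ∀ (r Bc : ℝ), r ≤ δ₀ → 0 ≤ Bc →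
      (1 : ℝ) ^ 2 * M₂ * (∑ i, ‖b i‖) * Real.sqrt (Fintype.card ι) * Real.exp (r * d₀) * Λ * B6.c1 dL δ₀ (1 / 12) * Bc ≤ gX * Bc := by
    intro r Bc hr hBc
    have h1 : (1 : ℝ) ^ 2 * M₂ * (∑ i, ‖b i‖) * Real.sqrt (Fintype.card ι) * Real.exp (r * d₀) * Λ * B6.c1 dL δ₀ (1 / 12)
        ≤ (1 : ℝ) ^ 2 * M₂ * Sb * sι * Real.exp (δ₀ * d₀) * Λ * c₁ := by
      rw [← hSbdef, ← hsι, ← hc₁]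
      exact mul_le_mul_of_nonneg_right (mul_le_mul_of_nonneg_right (mul_le_mul_of_nonneg_left (hexp1 r hr) (by positivity)) hΛ0) hc₁0
    have h2 : (1 : ℝ) ^ 2 * M₂ * Sb * sι * Real.exp (δ₀ * d₀) * Λ * c₁ ≤ gX := by rw [hgX]; linarith
    exact mul_le_mul_of_nonneg_right (h1.trans h2) hBc
  have hstepI : ∀ (r Bc : ℝ), r ≤ δ₀ → 0 ≤ Bc →
      (B6.c1 dL δ₀ (1 / 12) * M₂ * (∑ i, ‖b i‖) * Real.sqrt (Fintype.card ι)
        * ((1 : ℝ) ^ 2 * Real.exp (r * d₀) * Λ + (1 : ℝ) ^ 4 * cP * σ₁ * Real.exp (r * (2 * d₀)) * Λ)) * Bc ≤ gI * Bc := by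
    intro r Bc hr hBc
    refine mul_le_mul_of_nonneg_right ?_ hBc
    rw [← hSbdef, ← hsι, ← hc₁, hgI]
    have hin : (1 : ℝ) ^ 2 * Real.exp (r * d₀) * Λ + (1 : ℝ) ^ 4 * cP * σ₁ * Real.exp (r * (2 * d₀)) * Λ
        ≤ (1 : ℝ) ^ 2 * Real.exp (δ₀ * d₀) * Λ + (1 : ℝ) ^ 4 * cP * σ₁ * Real.exp (δ₀ * (2 * d₀)) * Λ :=
      add_le_add (mul_le_mul_of_nonneg_right (mul_le_mul_of_nonneg_left (hexp1 r hr) (by positivity)) hΛ0)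
        (mul_le_mul_of_nonneg_right (mul_le_mul_of_nonneg_left (hexp2 r hr) (by positivity)) hΛ0)
    have h0 : 0 ≤ c₁ * M₂ * Sb * sι := by positivity
    have := mul_le_mul_of_nonneg_left hin h0
    linarith
  -- FIRST ORDER: the two cross conversions (rate ρ₁)
  have x1 : ∀ μ, HasL2Majorant (g := toB6 (geo9Y x) (0 : ℝ) True) (fun q : (Fin (d + 1) × SiteY x.toKIdx) × ι => blkC x.toKIdx ιB q.1.2) (conj b (D (Sum.inr μ)) * Gb) (fun p q => (gX * Bin) * (geo9Y x).len p * Real.exp (-(ρ₁ * (geo9Y x).dist p q))) := fun μ => by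
    have h := hasL2Majorant_cross_left b (bT (shiftY x.toKIdx)) (bU (UboxY x.toKIdx U)) (Rr := (0 : ℝ)) (H := True) (g := geo9Y x) (fun q : Fin (d + 1) × SiteY x.toKIdx => blkC x.toKIdx ιB q.2) dL
      (((η : ℂ))⁻¹) 1 d₀ M₂ δ₀ δ₀ (1 / 12) (1 / 12) ρ₁ Λ Bin (fun p => (geo9Y x).len p) hwℓ hδ₀.le hM₂ hBin0 hΛ0 hρ₁0 hr₁ hρ₁δ hrepr hdnn htri h261 hT1
      hρu hd₀B μ (Gp := Gb) (r1 μ)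
    exact hasL2Majorant_mono (g := toB6 (geo9Y x) (0 : ℝ) True) _ h fun p q =>
      mul_le_mul_of_nonneg_right (mul_le_mul_of_nonneg_right (hstep δ₀ Bin le_rfl hBin0) (hwℓ p)) (Real.exp_nonneg _)
  have x2 : ∀ μ, HasL2Majorant (g := toB6 (geo9Y x) (0 : ℝ) True) (fun q : (Fin (d + 1) × SiteY x.toKIdx) × ι => blkC x.toKIdx ιB q.1.2) (Gb * conj b (D (Sum.inl μ))) (fun p q => (gX * Bin) * (geo9Y x).len p * Real.exp (-(ρ₁ * (geo9Y x).dist p q))) := fun μ => by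
    have h := hasL2Majorant_cross_right b (bT (shiftY x.toKIdx)) (bU (UboxY x.toKIdx U)) (Rr := (0 : ℝ)) (H := True) (g := geo9Y x) (fun q : Fin (d + 1) × SiteY x.toKIdx => blkC x.toKIdx ιB q.2) dL
      (((η : ℂ))⁻¹) 1 d₀ M₂ δ₀ δ₀ (1 / 12) (1 / 12) ρ₁ Λ Bin (fun p => (geo9Y x).len p) hwℓ hM₂ hBin0 hΛ hρ₁0 hr₁ hαδ hrepr hdnn htri h261
      hρu hd₀F μ (Gp := Gb) (r2 μ)
    exact hasL2Majorant_mono (g := toB6 (geo9Y x) (0 : ℝ) True) _ h fun p q =>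
      mul_le_mul_of_nonneg_right (mul_le_mul_of_nonneg_right (hstep ρ₁ Bin hρ₁δ hBin0) (hwℓ p)) (Real.exp_nonneg _)
  -- MIXED words `D k * Gb * D l`: (inl, inr) read; (inr, inr) left cross; (inl, inl) right cross; (inr, inl) both (rate ρ₂)
  have m_rr : ∀ μ ν, HasL2Majorant (g := toB6 (geo9Y x) (0 : ℝ) True) (fun q : (Fin (d + 1) × SiteY x.toKIdx) × ι => blkC x.toKIdx ιB q.1.2) (conj b (D (Sum.inr μ)) * (Gb * conj b (D (Sum.inr ν)))) (fun p q => (gX * Bin) * 1 * Real.exp (-(ρ₁ * (geo9Y x).dist p q))) :=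
    fun μ ν => by
    have hin : HasL2Majorant (g := toB6 (geo9Y x) (0 : ℝ) True) (fun q : (Fin (d + 1) × SiteY x.toKIdx) × ι => blkC x.toKIdx ιB q.1.2) (conj b (D (Sum.inl μ)) * (Gb * conj b (D (Sum.inr ν)))) (fun p q => Bin * 1 * Real.exp (-(δ₀ * (geo9Y x).dist p q))) := by
      rw [← mul_assoc]; exact r4 μ ν
    have h := hasL2Majorant_cross_left b (bT (shiftY x.toKIdx)) (bU (UboxY x.toKIdx U)) (Rr := (0 : ℝ)) (H := True) (g := geo9Y x) (fun q : Fin (d + 1) × SiteY x.toKIdx => blkC x.toKIdx ιB q.2) dL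
      (((η : ℂ))⁻¹) 1 d₀ M₂ δ₀ δ₀ (1 / 12) (1 / 12) ρ₁ Λ Bin (fun _ => (1 : ℝ)) (fun _ => zero_le_one) hδ₀.le hM₂ hBin0 hΛ0 hρ₁0 hr₁ hρ₁δ hrepr hdnn htri
      h261 hT0 hρu hd₀B μ (Gp := Gb * conj b (D (Sum.inr ν))) hin
    exact hasL2Majorant_mono (g := toB6 (geo9Y x) (0 : ℝ) True) _ h fun p q =>
      mul_le_mul_of_nonneg_right (mul_le_mul_of_nonneg_right (hstep δ₀ Bin le_rfl hBin0) zero_le_one) (Real.exp_nonneg _)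
  have m_ll : ∀ μ ν, HasL2Majorant (g := toB6 (geo9Y x) (0 : ℝ) True) (fun q : (Fin (d + 1) × SiteY x.toKIdx) × ι => blkC x.toKIdx ιB q.1.2) (conj b (D (Sum.inl μ)) * Gb * conj b (D (Sum.inl ν))) (fun p q => (gX * Bin) * 1 * Real.exp (-(ρ₁ * (geo9Y x).dist p q))) :=
    fun μ ν => by
    have h := hasL2Majorant_cross_right b (bT (shiftY x.toKIdx)) (bU (UboxY x.toKIdx U)) (Rr := (0 : ℝ)) (H := True) (g := geo9Y x) (fun q : Fin (d + 1) × SiteY x.toKIdx => blkC x.toKIdx ιB q.2) dL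
      (((η : ℂ))⁻¹) 1 d₀ M₂ δ₀ δ₀ (1 / 12) (1 / 12) ρ₁ Λ Bin (fun _ => (1 : ℝ)) (fun _ => zero_le_one) hM₂ hBin0 hΛ hρ₁0 hr₁ hαδ hrepr hdnn htri h261
      hρu hd₀F ν (Gp := conj b (D (Sum.inl μ)) * Gb) (r4 μ ν)
    exact hasL2Majorant_mono (g := toB6 (geo9Y x) (0 : ℝ) True) _ h fun p q =>
      mul_le_mul_of_nonneg_right (mul_le_mul_of_nonneg_right (hstep ρ₁ Bin hρ₁δ hBin0) zero_le_one) (Real.exp_nonneg _)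
  have m_rl : ∀ μ ν, HasL2Majorant (g := toB6 (geo9Y x) (0 : ℝ) True) (fun q : (Fin (d + 1) × SiteY x.toKIdx) × ι => blkC x.toKIdx ιB q.1.2) (conj b (D (Sum.inr μ)) * (Gb * conj b (D (Sum.inl ν)))) (fun p q => (gX * (gX * Bin)) * 1 * Real.exp (-(ρ₂ * (geo9Y x).dist p q))) :=
    fun μ ν => by
    have hin : HasL2Majorant (g := toB6 (geo9Y x) (0 : ℝ) True) (fun q : (Fin (d + 1) × SiteY x.toKIdx) × ι => blkC x.toKIdx ιB q.1.2) (conj b (D (Sum.inl μ)) * (Gb * conj b (D (Sum.inl ν)))) (fun p q => (gX * Bin) * 1 * Real.exp (-(ρ₁ * (geo9Y x).dist p q))) := by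
      rw [← mul_assoc]; exact m_ll μ ν
    have h := hasL2Majorant_cross_left b (bT (shiftY x.toKIdx)) (bU (UboxY x.toKIdx U)) (Rr := (0 : ℝ)) (H := True) (g := geo9Y x) (fun q : Fin (d + 1) × SiteY x.toKIdx => blkC x.toKIdx ιB q.2) dL
      (((η : ℂ))⁻¹) 1 d₀ M₂ δ₀ ρ₁ (1 / 12) (1 / 12) ρ₂ Λ (gX * Bin) (fun _ => (1 : ℝ)) (fun _ => zero_le_one) hρ₁0 hM₂ (mul_nonneg hgX0 hBin0) hΛ0 hρ₂0 hr₂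
      hρ₂₁ hrepr hdnn htri h261 hT0 hρu hd₀B μ (Gp := Gb * conj b (D (Sum.inl ν))) hin
    exact hasL2Majorant_mono (g := toB6 (geo9Y x) (0 : ℝ) True) _ h fun p q =>
      mul_le_mul_of_nonneg_right (mul_le_mul_of_nonneg_right (hstep ρ₁ (gX * Bin) hρ₁δ (mul_nonneg hgX0 hBin0)) zero_le_one) (Real.exp_nonneg _)
  -- SECOND ORDER LEFT `D k * D l * Gb`: inner switch (inl, inr) at ρ₁; outer (inr, inl) at ρ₁ and (inr, inr) at ρ₂
  have w3_li : ∀ μ ν, HasL2Majorant (g := toB6 (geo9Y x) (0 : ℝ) True) (fun q : (Fin (d + 1) × SiteY x.toKIdx) × ι => blkC x.toKIdx ιB q.1.2) (conj b (D (Sum.inl μ)) * conj b (D (Sum.inr ν)) * Gb) (fun p q => (gI * Bin) * 1 * Real.exp (-(ρ₁ * (geo9Y x).dist p q))) :=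
    fun μ ν => by
    have h := hasL2Majorant_cross2_left_inner b (bT (shiftY x.toKIdx)) (bU (UboxY x.toKIdx U)) (Rr := (0 : ℝ)) (H := True) (g := geo9Y x)
      (fun q : Fin (d + 1) × SiteY x.toKIdx => blkC x.toKIdx ιB q.2) dL hη0 1 cP σ₁ d₀ M₂ δ₀ δ₀ (1 / 12) (1 / 12) ρ₁ Λ Λ Bin hcP hσ₁0 hδ₀.le hM₂ hBin0 hΛ0 hΛ0 hρ₁0 hr₁ hρ₁δ hrepr hdnn
      htri hlen h261 hT0 hT1 μ ν (hcomm μ ν) hρu (hplaq' μ ν) hd₀FB (hσ ν) heta (Gp := Gb) (r3 μ ν) (r1 ν)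
    exact hasL2Majorant_mono (g := toB6 (geo9Y x) (0 : ℝ) True) _ h fun p q =>
      mul_le_mul_of_nonneg_right (mul_le_mul_of_nonneg_right (hstepI δ₀ Bin le_rfl hBin0) zero_le_one) (Real.exp_nonneg _)
  have w3_rl : ∀ μ ν, HasL2Majorant (g := toB6 (geo9Y x) (0 : ℝ) True) (fun q : (Fin (d + 1) × SiteY x.toKIdx) × ι => blkC x.toKIdx ιB q.1.2) (conj b (D (Sum.inr μ)) * (conj b (D (Sum.inl ν)) * Gb)) (fun p q => (gX * Bin) * 1 * Real.exp (-(ρ₁ * (geo9Y x).dist p q))) :=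
    fun μ ν => by
    have hin : HasL2Majorant (g := toB6 (geo9Y x) (0 : ℝ) True) (fun q : (Fin (d + 1) × SiteY x.toKIdx) × ι => blkC x.toKIdx ιB q.1.2) (conj b (D (Sum.inl μ)) * (conj b (D (Sum.inl ν)) * Gb)) (fun p q => Bin * 1 * Real.exp (-(δ₀ * (geo9Y x).dist p q))) := by
      rw [← mul_assoc]; exact r3 μ ν
    have h := hasL2Majorant_cross_left b (bT (shiftY x.toKIdx)) (bU (UboxY x.toKIdx U)) (Rr := (0 : ℝ)) (H := True) (g := geo9Y x) (fun q : Fin (d + 1) × SiteY x.toKIdx => blkC x.toKIdx ιB q.2) dL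
      (((η : ℂ))⁻¹) 1 d₀ M₂ δ₀ δ₀ (1 / 12) (1 / 12) ρ₁ Λ Bin (fun _ => (1 : ℝ)) (fun _ => zero_le_one) hδ₀.le hM₂ hBin0 hΛ0 hρ₁0 hr₁ hρ₁δ hrepr hdnn htri
      h261 hT0 hρu hd₀B μ (Gp := conj b (D (Sum.inl ν)) * Gb) hin
    exact hasL2Majorant_mono (g := toB6 (geo9Y x) (0 : ℝ) True) _ h fun p q =>
      mul_le_mul_of_nonneg_right (mul_le_mul_of_nonneg_right (hstep δ₀ Bin le_rfl hBin0) zero_le_one) (Real.exp_nonneg _)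
  have w3_rr : ∀ μ ν, HasL2Majorant (g := toB6 (geo9Y x) (0 : ℝ) True) (fun q : (Fin (d + 1) × SiteY x.toKIdx) × ι => blkC x.toKIdx ιB q.1.2) (conj b (D (Sum.inr μ)) * (conj b (D (Sum.inr ν)) * Gb)) (fun p q => (gX * (gI * Bin)) * 1 * Real.exp (-(ρ₂ * (geo9Y x).dist p q))) :=
    fun μ ν => by
    have hin : HasL2Majorant (g := toB6 (geo9Y x) (0 : ℝ) True) (fun q : (Fin (d + 1) × SiteY x.toKIdx) × ι => blkC x.toKIdx ιB q.1.2) (conj b (D (Sum.inl μ)) * (conj b (D (Sum.inr ν)) * Gb)) (fun p q => (gI * Bin) * 1 * Real.exp (-(ρ₁ * (geo9Y x).dist p q))) := by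
      rw [← mul_assoc]; exact w3_li μ ν
    have h := hasL2Majorant_cross_left b (bT (shiftY x.toKIdx)) (bU (UboxY x.toKIdx U)) (Rr := (0 : ℝ)) (H := True) (g := geo9Y x) (fun q : Fin (d + 1) × SiteY x.toKIdx => blkC x.toKIdx ιB q.2) dL
      (((η : ℂ))⁻¹) 1 d₀ M₂ δ₀ ρ₁ (1 / 12) (1 / 12) ρ₂ Λ (gI * Bin) (fun _ => (1 : ℝ)) (fun _ => zero_le_one) hρ₁0 hM₂ (mul_nonneg hgI0 hBin0) hΛ0 hρ₂0 hr₂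
      hρ₂₁ hrepr hdnn htri h261 hT0 hρu hd₀B μ (Gp := conj b (D (Sum.inr ν)) * Gb) hin
    exact hasL2Majorant_mono (g := toB6 (geo9Y x) (0 : ℝ) True) _ h fun p q =>
      mul_le_mul_of_nonneg_right (mul_le_mul_of_nonneg_right (hstep ρ₁ (gI * Bin) hρ₁δ (mul_nonneg hgI0 hBin0)) zero_le_one) (Real.exp_nonneg _)
  -- SECOND ORDER RIGHT `Gb * D k * D l`: inner switch (inl, inr) at ρ₁; outer (inr, inl) at ρ₁ and (inl, inl) at ρ₂
  have w5_li : ∀ μ ν, HasL2Majorant (g := toB6 (geo9Y x) (0 : ℝ) True) (fun q : (Fin (d + 1) × SiteY x.toKIdx) × ι => blkC x.toKIdx ιB q.1.2) (Gb * conj b (D (Sum.inl μ)) * conj b (D (Sum.inr ν))) (fun p q => (gI * Bin) * 1 * Real.exp (-(ρ₁ * (geo9Y x).dist p q))) :=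
    fun μ ν => by
    have h := hasL2Majorant_cross2_right_inner b (bT (shiftY x.toKIdx)) (bU (UboxY x.toKIdx U)) (Rr := (0 : ℝ)) (H := True) (g := geo9Y x)
      (fun q : Fin (d + 1) × SiteY x.toKIdx => blkC x.toKIdx ιB q.2) dL hη0 1 cP σ₁ d₀ M₂ δ₀ δ₀ (1 / 12) (1 / 12) ρ₁ Λ Λ Bin hcP hσ₁0 hM₂ hBin0 hΛ0 hΛ0 hρ₁0 hr₁ hrepr hdnn
      htri hlen h261 hT0 hTi2 μ ν (hcomm μ ν) hρu (hplaq' μ ν) hd₀FB (hσ ν) heta (Gp := Gb) (r5 μ ν) (r2 μ)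
    exact hasL2Majorant_mono (g := toB6 (geo9Y x) (0 : ℝ) True) _ h fun p q =>
      mul_le_mul_of_nonneg_right (mul_le_mul_of_nonneg_right (hstepI ρ₁ Bin hρ₁δ hBin0) zero_le_one) (Real.exp_nonneg _)
  have w5_rl : ∀ μ ν, HasL2Majorant (g := toB6 (geo9Y x) (0 : ℝ) True) (fun q : (Fin (d + 1) × SiteY x.toKIdx) × ι => blkC x.toKIdx ιB q.1.2) (Gb * conj b (D (Sum.inr μ)) * conj b (D (Sum.inl ν))) (fun p q => (gX * Bin) * 1 * Real.exp (-(ρ₁ * (geo9Y x).dist p q))) :=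
    fun μ ν => by
    have h := hasL2Majorant_cross_right b (bT (shiftY x.toKIdx)) (bU (UboxY x.toKIdx U)) (Rr := (0 : ℝ)) (H := True) (g := geo9Y x) (fun q : Fin (d + 1) × SiteY x.toKIdx => blkC x.toKIdx ιB q.2) dL
      (((η : ℂ))⁻¹) 1 d₀ M₂ δ₀ δ₀ (1 / 12) (1 / 12) ρ₁ Λ Bin (fun _ => (1 : ℝ)) (fun _ => zero_le_one) hM₂ hBin0 hΛ hρ₁0 hr₁ hαδ hrepr hdnn htri h261
      hρu hd₀F ν (Gp := Gb * conj b (D (Sum.inr μ))) (r5 μ ν)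
    exact hasL2Majorant_mono (g := toB6 (geo9Y x) (0 : ℝ) True) _ h fun p q =>
      mul_le_mul_of_nonneg_right (mul_le_mul_of_nonneg_right (hstep ρ₁ Bin hρ₁δ hBin0) zero_le_one) (Real.exp_nonneg _)
  have w5_ll : ∀ μ ν, HasL2Majorant (g := toB6 (geo9Y x) (0 : ℝ) True) (fun q : (Fin (d + 1) × SiteY x.toKIdx) × ι => blkC x.toKIdx ιB q.1.2) (Gb * conj b (D (Sum.inl μ)) * conj b (D (Sum.inl ν))) (fun p q => (gX * (gI * Bin)) * 1 * Real.exp (-(ρ₂ * (geo9Y x).dist p q))) :=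
    fun μ ν => by
    have h := hasL2Majorant_cross_right b (bT (shiftY x.toKIdx)) (bU (UboxY x.toKIdx U)) (Rr := (0 : ℝ)) (H := True) (g := geo9Y x) (fun q : Fin (d + 1) × SiteY x.toKIdx => blkC x.toKIdx ιB q.2) dL
      (((η : ℂ))⁻¹) 1 d₀ M₂ δ₀ ρ₁ (1 / 12) (1 / 12) ρ₂ Λ (gI * Bin) (fun _ => (1 : ℝ)) (fun _ => zero_le_one) hM₂ (mul_nonneg hgI0 hBin0) hΛ hρ₂0 hr₂ hαδ
      hrepr hdnn htri h261 hρu hd₀F ν (Gp := Gb * conj b (D (Sum.inl μ))) (w5_li μ ν)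
    exact hasL2Majorant_mono (g := toB6 (geo9Y x) (0 : ℝ) True) _ h fun p q =>
      mul_le_mul_of_nonneg_right (mul_le_mul_of_nonneg_right (hstep ρ₂ (gI * Bin) (hρ₂₁.trans hρ₁δ) (mul_nonneg hgI0 hBin0)) zero_le_one)
        (Real.exp_nonneg _)
  -- assemble: common constant `Bx = g_X²·g_I·Bin`, common rate `δ₀/2`
  have hBx0 : 0 ≤ Bx := by rw [hBx]; positivity
  have hle1 : Bin ≤ Bx := by
    rw [hBx]
    calc Bin ≤ gI * Bin := le_mul_of_one_le_left hBin0 hgI1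
      _ ≤ gX ^ 2 * (gI * Bin) := le_mul_of_one_le_left (mul_nonneg hgI0 hBin0) (one_le_pow₀ hgX1)
      _ = gX ^ 2 * gI * Bin := by ring
  have hle2 : gX * Bin ≤ Bx := by
    rw [hBx]
    calc gX * Bin ≤ gX * (gI * Bin) := mul_le_mul_of_nonneg_left (le_mul_of_one_le_left hBin0 hgI1) hgX0
      _ ≤ gX * (gX * (gI * Bin)) := mul_le_mul_of_nonneg_left (le_mul_of_one_le_left (mul_nonneg hgI0 hBin0) hgX1) hgX0
      _ = gX ^ 2 * gI * Bin := by ring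
  have hle3 : gI * Bin ≤ Bx := by
    rw [hBx]
    calc gI * Bin ≤ gX ^ 2 * (gI * Bin) := le_mul_of_one_le_left (mul_nonneg hgI0 hBin0) (one_le_pow₀ hgX1)
      _ = gX ^ 2 * gI * Bin := by ring
  have hle4 : gX * (gI * Bin) ≤ Bx := by
    rw [hBx]
    calc gX * (gI * Bin) ≤ gX * (gX * (gI * Bin)) := mul_le_mul_of_nonneg_left (le_mul_of_one_le_left (mul_nonneg hgI0 hBin0) hgX1) hgX0
      _ = gX ^ 2 * gI * Bin := by ring
  have hle5 : gX * (gX * Bin) ≤ Bx := by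
    rw [hBx]
    calc gX * (gX * Bin) ≤ gX * (gX * (gI * Bin)) :=
          mul_le_mul_of_nonneg_left (mul_le_mul_of_nonneg_left (le_mul_of_one_le_left hBin0 hgI1) hgX0) hgX0
      _ = gX ^ 2 * gI * Bin := by ring
  have mono : ∀ {Tm : Module.End ℝ ((Fin (d + 1) × SiteY x.toKIdx) × ι → ℝ)} {Bc r : ℝ} (w : (geo9Y x).Site → ℝ), (∀ p, 0 ≤ w p) → 0 ≤ Bc → Bc ≤ Bx →
      δ₀ / 2 ≤ r →
      HasL2Majorant (g := toB6 (geo9Y x) (0 : ℝ) True) (fun q : (Fin (d + 1) × SiteY x.toKIdx) × ι => blkC x.toKIdx ιB q.1.2) Tm (fun p q => Bc * w p * Real.exp (-(r * (geo9Y x).dist p q))) →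
      HasL2Majorant (g := toB6 (geo9Y x) (0 : ℝ) True) (fun q : (Fin (d + 1) × SiteY x.toKIdx) × ι => blkC x.toKIdx ιB q.1.2) Tm (fun p q => cLGY cP M₂ (∑ j, ‖b j‖) (Real.sqrt (Fintype.card ι)) d dL δ₀ Λ * B₀ * w p * Real.exp (-(δ₀ / 2 * (geo9Y x).dist p q))) := by
    intro Tm Bc r w hw hBc hBcx hr h
    have h' := hasL2Majorant_rate_mono (R := (0 : ℝ)) (H := True) (g := geo9Y x) _ Bc w hBc hw hr hdnn h
    exact hasL2Majorant_mono (g := toB6 (geo9Y x) (0 : ℝ) True) _ h' fun p q => by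
      rw [← hBxdef]; exact mul_le_mul_of_nonneg_right (mul_le_mul_of_nonneg_right hBcx (hw p)) (Real.exp_nonneg _)
  have h01 : δ₀ / 2 ≤ ρ₁ := by rw [hρ₁]; linarith
  have h02 : δ₀ / 2 ≤ ρ₂ := by rw [hρ₂]; linarith
  have h00 : δ₀ / 2 ≤ δ₀ := by linarith
  have hw0 : ∀ _p : (geo9Y x).Site, (0 : ℝ) ≤ 1 := fun _ => zero_le_one
  refine ⟨?_, fun k => ?_, fun k => ?_, fun k l => ?_, fun k l => ?_, fun k l => ?_⟩
  · exact mono (fun p => (geo9Y x).len p ^ 2) (fun p => sq_nonneg _) hBin0 hle1 h00 r0'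
  · cases k with
    | inl μ => exact mono (fun p => (geo9Y x).len p) hwℓ hBin0 hle1 h00 (r1 μ)
    | inr μ => exact mono (fun p => (geo9Y x).len p) hwℓ (mul_nonneg hgX0 hBin0) hle2 h01 (x1 μ)
  · cases k with
    | inl μ => exact mono (fun p => (geo9Y x).len p) hwℓ (mul_nonneg hgX0 hBin0) hle2 h01 (x2 μ)
    | inr μ => exact mono (fun p => (geo9Y x).len p) hwℓ hBin0 hle1 h00 (r2 μ)
  · cases k with
    | inl μ =>
      cases l with
      | inl ν => exact mono (fun _ => (1 : ℝ)) hw0 hBin0 hle1 h00 (r3 μ ν)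
      | inr ν => exact mono (fun _ => (1 : ℝ)) hw0 (mul_nonneg hgI0 hBin0) hle3 h01 (w3_li μ ν)
    | inr μ =>
      cases l with
      | inl ν =>
        rw [mul_assoc]
        exact mono (fun _ => (1 : ℝ)) hw0 (mul_nonneg hgX0 hBin0) hle2 h01 (w3_rl μ ν)
      | inr ν =>
        rw [mul_assoc]
        exact mono (fun _ => (1 : ℝ)) hw0 (mul_nonneg hgX0 (mul_nonneg hgI0 hBin0)) hle4 h02 (w3_rr μ ν)
  · cases k with
    | inl μ =>
      cases l with
      | inl ν => exact mono (fun _ => (1 : ℝ)) hw0 (mul_nonneg hgX0 hBin0) hle2 h01 (m_ll μ ν)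
      | inr ν => exact mono (fun _ => (1 : ℝ)) hw0 hBin0 hle1 h00 (r4 μ ν)
    | inr μ =>
      cases l with
      | inl ν =>
        rw [mul_assoc]
        exact mono (fun _ => (1 : ℝ)) hw0 (mul_nonneg hgX0 (mul_nonneg hgX0 hBin0)) hle5 h02 (m_rl μ ν)
      | inr ν =>
        rw [mul_assoc]
        exact mono (fun _ => (1 : ℝ)) hw0 (mul_nonneg hgX0 hBin0) hle2 h01 (m_rr μ ν)
  · cases k with
    | inl μ =>
      cases l with
      | inl ν => exact mono (fun _ => (1 : ℝ)) hw0 (mul_nonneg hgX0 (mul_nonneg hgI0 hBin0)) hle4 h02 (w5_ll μ ν)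
      | inr ν => exact mono (fun _ => (1 : ℝ)) hw0 (mul_nonneg hgI0 hBin0) hle3 h01 (w5_li μ ν)
    | inr μ =>
      cases l with
      | inl ν => exact mono (fun _ => (1 : ℝ)) hw0 (mul_nonneg hgX0 hBin0) hle2 h01 (w5_rl μ ν)
      | inr ν => exact mono (fun _ => (1 : ℝ)) hw0 hBin0 hle1 h00 (r5 μ ν)

end All

end Literature.MathematicalPhysics.QuantumFieldTheory.Balaban1983to89.B9SectBL2GReadCodedQY

end
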